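import Literature.InformationTheory.QuantumCodes.CSSDistanceHardness
import HarnessLib

/-!
# Kapshikar–Kundu 2023, Theorem 2: the minimum-distance problem for stabilizer codes is NP-hard — PROVED

Discharge of the named fact `KapshikarKundu2023_quantumMinimumDistance_isNPHard : IsNPHard QMINDIST`
of `QuantumCodes/MinimumDistanceHardness.lean` (U. Kapshikar, S. Kundu, *On the hardness of the
minimum distance problem of quantum codes*, IEEE Trans. Inform. Theory 69 (2023) 6293–6302 =
arXiv:2203.04262, §4 Theorem 2 with §4.1: QMD is NP-hard for the stabilizer-generator input
`S ∈ 𝔽₂^{r × 2n}`).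

## Proof route (this file; NOT the printed one)

As for the CSS version (`CSSDistanceHardness.lean`, whose module docstring explains the deviation from
the printed CWS/polarity-graph reduction from Vardy's MINIMUM DISTANCE): the source problem is
COSET WEIGHTS [BerlekampMcelieceVantilborg1978, §III.A], NP-hard by the tree's theorem
`BerlekampMcElieceVanTilborg1978_cosetWeights_isNPHard`, and the reduction
`COSETWEIGHTS ≤ₚ QMINDIST` writes the SAME `k = 1` CSS code as `CSSDistHard.flatInst`, now as a
stabilizer matrix: the rows `(0 | h)` for the Z-checks `h` followed by the rows `(h' | 0)` for the
X-checks `h'` (`StabDistHard.qRows`). Its row span is the CSS stabilizer space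
(`StabDistHard.rowSpan_qRows`), so the yes-sets agree (`StabDistHard.qInst_mem_iff`) and
`CSSDistHard.flat_mem_iff` finishes. (A CSS code IS a stabilizer code; no Bravyi–Terhal–Leemhuis
mapping is needed in this direction.)

Main declarations:
* `StabDistHard.qInst_mem_iff` — the stabilizer-matrix instance is in `quantumMinimumDistanceSet`
  iff `(⟨m, n, A, y⟩, w) ∈ cosetWeightsSet`;
* `StabDistHard.COSETWEIGHTS_karpReducible_QMINDIST : COSETWEIGHTS ≤ₚ QMINDIST`;
* **`KapshikarKundu2023_quantumMinimumDistance_isNPHard_holds`**.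

## References

* [KapshikarKundu2023] U. Kapshikar, S. Kundu, IEEE Trans. Inform. Theory 69 (2023) 6293–6302 =
  arXiv:2203.04262 (held: `paper:arxiv-2203.04262`), §2.2.1 (symplectic input), §3 Problem 4,
  §4 Theorem 2 (chunk p0014: "Theorem 2. QMD is NP-complete. …"), §4.1 (chunk p0015: "our hardness
  results from Theorem 2 translate to the standard input of the stabilizer framework as well").
* [BerlekampMcelieceVantilborg1978] E. R. Berlekamp, R. J. McEliece, H. C. A. van Tilborg, IEEE
  Trans. Inform. Theory 24 (1978) 384–386, §III.A (COSET WEIGHTS).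
* [AroraBarak2009] S. Arora, B. Barak, *Computational Complexity*, CUP 2009, §0.1, §1.3, Def. 2.7.

## Mathlib / tree search

`lean search 'QMINDIST|quantumMinimumDistanceSet'` (2026-08-27): only the statement file. Reused:
everything of `CSSDistanceHardness.lean` (entry bricks `xbitF`/`zbitF`, size bricks, `flatInst`,
`flat_mem_iff`), the guard `CosetWeightsNP.T`, `rowSpan`/`cssRowSpan` of
`MinimumDistanceHardness.lean`.
-/

noncomputable section

namespace Literature.InformationTheory.QuantumCodes

open _root_.Computability Literature.Computability.Complexity Literature.InformationTheory.Coding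
open scoped Literature.Computability.Complexity.Notation
open CSSDistHard

namespace StabDistHard

variable {m n : ℕ} (A : Fin m → Fin n → ZMod 2) (y : Fin n → ZMod 2)

/-! ### The stabilizer matrix of the CSS code -/

/-- **The stabilizer matrix** of the `k = 1` CSS code of `CSSDistanceHardness.lean`: the rows
`(0 | h)`, `h` a row of `H_Z` (indices `< nQ + m`), then the rows `(h' | 0)`, `h'` a row of `H_X`.
[cite: KapshikarKundu2023, §2.2.1 ("each row … is interpreted as a string of the form (a|b)") and §4.1 (S_X, S_Z)] -/
def qRows : Fin (nQ m n + m + n * (m + 1)) → SympVec (nQ m n) :=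
  Sum.elim (fun j => ((0, HZf A y j) : SympVec (nQ m n))) (fun i => ((HXf A y i, 0) : SympVec (nQ m n))) ∘
    finSumFinEquiv.symm

/-- **The row span of the stabilizer matrix is the CSS stabilizer space.**
[cite: KapshikarKundu2023, §4.1 (S_X = {X(c)}, S_Z = {Z(c)})] -/
theorem rowSpan_qRows : rowSpan (qRows A y) = cssRowSpan (HXf A y) (HZf A y) := by
  unfold rowSpan cssRowSpan qRows
  rw [EquivLike.range_comp, Set.Sum.elim_range, Set.union_comm]

/-- **The QMD instance** `(⟨nQ + m + n(m+1), nQ, rows⟩, min(w, m) + 1)`.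
[construction of `CSSDistanceHardness.lean`] [cite: KapshikarKundu2023, §4 Theorem 2 (statement), §4.1] -/
def qInst (m n : ℕ) (A : Fin m → Fin n → ZMod 2) (y : Fin n → ZMod 2) (w : ℕ) :
    (Σ r : ℕ, Σ n' : ℕ, Fin r → SympVec n') × ℕ :=
  (⟨nQ m n + m + n * (m + 1), nQ m n, qRows A y⟩, min w m + 1)

/-- **The QMD instance is a YES instance iff `(A, y, w)` is a YES instance of COSET WEIGHTS**
(same stabilizer space as the CSS instance, then `CSSDistHard.flat_mem_iff`).
[cite: KapshikarKundu2023, §4 Theorem 2 (statement), §4.1] -/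
theorem qInst_mem_iff (w : ℕ) :
    qInst m n A y w ∈ quantumMinimumDistanceSet ↔
      ((⟨m, n, (A, y)⟩ : Σ m : ℕ, Σ n : ℕ, (Fin m → Fin n → ZMod 2) × (Fin n → ZMod 2)), w) ∈ cosetWeightsSet := by
  rw [← flat_mem_iff A y w]
  change (IsSelfOrthogonal (rowSpan (qRows A y)) ∧
    ∃ P ∈ sympDual (rowSpan (qRows A y)), P ∉ rowSpan (qRows A y) ∧ sympWeight P ≤ min w m + 1) ↔
    (IsSelfOrthogonal (cssRowSpan (HXf A y) (HZf A y)) ∧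
    ∃ P ∈ sympDual (cssRowSpan (HXf A y) (HZf A y)), P ∉ cssRowSpan (HXf A y) (HZf A y) ∧
      sympWeight P ≤ min w m + 1)
  rw [rowSpan_qRows]

/-! ### The instance written by the machine: Boolean entries -/

section Entries

variable (Ab : ℕ → ℕ → Bool) (yb : ℕ → Bool)

/-- X-part entry of row `r`, qubit `u`: zero on the Z-block `r < nQ + m`, the `H_X` entry of row
`r - (nQ + m)` after it (`r / (nQ+m)`, `r % (nQ+m)` in the machine). [cite: KapshikarKundu2023, §2.2.1] -/
def aEntry (m n : ℕ) (r u : ℕ) : Bool :=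
  !decide (r / (nQ m n + m) = 0) && xEntry Ab yb m (r % (nQ m n + m)) u

/-- Z-part entry of row `r`, qubit `u`: the `H_Z` entry on the Z-block, zero after it. [cite: KapshikarKundu2023, §2.2.1] -/
def bEntry (m n : ℕ) (r u : ℕ) : Bool :=
  decide (r / (nQ m n + m) = 0) && zEntry Ab m n r u

/-- The stabilizer matrix read off bit tables. [cite: KapshikarKundu2023, §2.2.1] -/
def qRowsB (m n : ℕ) : Fin (nQ m n + m + n * (m + 1)) → SympVec (nQ m n) := fun r =>
  (fun u => if aEntry Ab yb m n r u then 1 else 0, fun u => if bEntry Ab m n r u then 1 else 0)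

/-- **The machine's stabilizer matrix is the stabilizer matrix.** [cite: KapshikarKundu2023, §2.2.1] -/
theorem qRowsB_eq (m n : ℕ) : qRowsB Ab yb m n = qRows (matOfBits Ab m n) (vecOfBits yb n) := by
  have hpos : 0 < nQ m n + m := Nat.add_pos_left (by unfold nQ; positivity) _
  funext r
  obtain ⟨ζ, rfl⟩ := finSumFinEquiv.surjective r
  simp only [qRows, Function.comp_apply, Equiv.symm_apply_apply]
  cases ζ with
  | inl j =>
    have hv : ((finSumFinEquiv (Sum.inl j) : Fin (nQ m n + m + n * (m + 1))) : ℕ) = j := by simp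
    have hq : ((finSumFinEquiv (Sum.inl j) : Fin (nQ m n + m + n * (m + 1))) : ℕ) / (nQ m n + m) = 0 := by
      rw [hv]; exact Nat.div_eq_of_lt j.2
    simp only [qRowsB, aEntry, bEntry, hq, decide_true, Bool.not_true, Bool.false_and, Bool.true_and, Sum.elim_inl]
    refine Prod.ext (funext fun u => by simp) (funext fun u => ?_)
    rw [hv]
    exact congr_fun (congr_fun (HZb_eq Ab yb m n) j) u
  | inr i =>
    have hv : ((finSumFinEquiv (Sum.inr i) : Fin (nQ m n + m + n * (m + 1))) : ℕ) = nQ m n + m + i := by simp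
    have hq : ((finSumFinEquiv (Sum.inr i) : Fin (nQ m n + m + n * (m + 1))) : ℕ) / (nQ m n + m) ≠ 0 := by
      rw [hv]; exact (Nat.div_pos (Nat.le_add_right _ _) hpos).ne'
    have hlt : (i : ℕ) < nQ m n + m := by
      have h1 : n * (m + 1) ≤ nQ m n := by
        unfold nQ
        calc n * (m + 1) ≤ (n + 1) * (m + 1) := Nat.mul_le_mul_right _ (Nat.le_succ n)
          _ ≤ (n + 1) * (m + 1) * (m + 2) := Nat.le_mul_of_pos_right _ (by omega)
      have := i.2; omega
    have hρ : ((finSumFinEquiv (Sum.inr i) : Fin (nQ m n + m + n * (m + 1))) : ℕ) % (nQ m n + m) = i := by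
      rw [hv, Nat.add_mod_left, Nat.mod_eq_of_lt hlt]
    simp only [qRowsB, aEntry, bEntry, hq, decide_false, Bool.not_false, Bool.false_and, Bool.true_and, Sum.elim_inr]
    refine Prod.ext (funext fun u => ?_) (funext fun u => by simp)
    rw [hρ]
    exact congr_fun (congr_fun (HXb_eq Ab yb m n) i) u

end Entries

/-- **The QMD instance written from the string `x`** (size parameters `m, n`). [cite: KapshikarKundu2023, §4 Theorem 2 (statement), §4.1] -/
def strInstQ (x : List Bool) (m n : ℕ) : (Σ r : ℕ, Σ n' : ℕ, Fin r → SympVec n') × ℕ :=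
  (⟨nQ m n + m + n * (m + 1), nQ m n, qRowsB (Abits x) (ybits x) m n⟩, min (CosetWeightsNP.wOf x) m + 1)

/-- The string instance is the QMD instance of the matrices read off the string. [cite: KapshikarKundu2023, §4 Theorem 2 (statement), §4.1] -/
theorem strInstQ_eq (x : List Bool) (m n : ℕ) :
    strInstQ x m n = qInst m n (matOfBits (Abits x) m n) (vecOfBits (ybits x) n) (CosetWeightsNP.wOf x) := by
  unfold strInstQ qInst
  rw [qRowsB_eq]

/-- **On a code, the string instance is a YES instance of QMD iff the coded COSET WEIGHTS instance is a
YES instance.** [cite: KapshikarKundu2023, §4 Theorem 2 (statement), §4.1] -/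
theorem strInstQ_mem_iff (x : List Bool) :
    strInstQ x (CosetWeightsNP.mOf x) (CosetWeightsNP.nOf x) ∈ quantumMinimumDistanceSet ↔
      CosetWeightsNP.instOf x ∈ cosetWeightsSet := by
  rw [strInstQ_eq, qInst_mem_iff]
  rfl

/-! ### A fixed NO instance -/

/-- A fixed NO instance: no qubits, no rows. [folklore] -/
def badQ : (Σ r : ℕ, Σ n' : ℕ, Fin r → SympVec n') × ℕ := (⟨0, 0, fun _ => 0⟩, 0)

/-- The NO instance is a no-instance. [folklore] -/
private theorem badQ_not_mem : badQ ∉ quantumMinimumDistanceSet := by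
  rintro ⟨-, w, -, hw, -⟩
  apply hw
  have : w = 0 := by
    ext i <;> exact Fin.elim0 i
  rw [this]
  exact Submodule.zero_mem _

/-! ### The machine: bricks -/

open Polynomial Brick HashBricks Plumb
open Literature.InformationTheory.Coding.CosetWeightsNP (mhat nhat)

/-- `1^{mZ + mX}`: the number of rows. [cite: AroraBarak2009, §1.3 (arithmetic on unary counters)] -/
def rowsU : List Bool → List Bool := fun z => mZx z ++ mXx z

/-- `rowsU ∈ FP`. [cite: AroraBarak2009, §1.3 (polynomial time is closed under composition and bounded loops)] -/
theorem rowsU_mem_FP : rowsU ∈ FP := append_mem_FP mZx_mem_FP mXx_mem_FP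

/-- Value of `rowsU`. [cite: AroraBarak2009, §1.3 (arithmetic on unary counters)] -/
theorem rowsU_apply (x : List Bool) : rowsU x = ones (nQ (mhat x) (nhat x) + mhat x + nhat x * (mhat x + 1)) := by
  show mZx x ++ mXx x = _
  rw [mZx_apply, mXx_apply, ones, ones, ones, ← List.replicate_add]

/-- On the entry record `⟨⟨x, 1ʳ⟩, 1ᵘ⟩`: `⟨1^{r / (mZ)}, 1^{r % mZ}⟩`. [folklore] -/
def qρ' : List Bool → List Bool := divModFn ∘ fanoutFn (mZx ∘ zX) zT
/-- On the entry record: `[r < mZ]`. [folklore] -/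
def q0' : List Bool → List Bool := eqPairFn ∘ fanoutFn (fstF ∘ qρ') (fun _ => [])
/-- On the entry record: the record `⟨⟨x, 1^{r % mZ}⟩, 1ᵘ⟩` of the `H_X` entry function. [folklore] -/
def xRec : List Bool → List Bool := fanoutFn (fanoutFn zX (sndF ∘ qρ')) sndF
/-- **The X-part entry function.** [cite: KapshikarKundu2023, §2.2.1] -/
def abitQ : List Bool → List Bool := andFn (notFn q0') (xbitF ∘ xRec)
/-- **The Z-part entry function.** [cite: KapshikarKundu2023, §2.2.1] -/
def bbitQ : List Bool → List Bool := andFn q0' zbitF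

/-- `qρ' ∈ FP`. [cite: AroraBarak2009, §1.3 (polynomial time is closed under composition and bounded loops)] -/
theorem qρ'_mem_FP : qρ' ∈ FP := comp_mem_FP divModFn_mem_FP (fanoutFn_mem_FP (comp_mem_FP mZx_mem_FP zX_mem_FP) zT_mem_FP)
/-- `q0' ∈ FP`. [cite: AroraBarak2009, §1.3 (polynomial time is closed under composition and bounded loops)] -/
theorem q0'_mem_FP : q0' ∈ FP :=
  comp_mem_FP eqPairFn_mem_FP (fanoutFn_mem_FP (comp_mem_FP fstF_mem_FP qρ'_mem_FP) (const_mem_FP _))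
/-- `xRec ∈ FP`. [cite: AroraBarak2009, §1.3 (polynomial time is closed under composition and bounded loops)] -/
theorem xRec_mem_FP : xRec ∈ FP :=
  fanoutFn_mem_FP (fanoutFn_mem_FP zX_mem_FP (comp_mem_FP sndF_mem_FP qρ'_mem_FP)) sndF_mem_FP
/-- `abitQ ∈ FP`. [cite: AroraBarak2009, §1.3 (polynomial time is closed under composition and bounded loops)] -/
theorem abitQ_mem_FP : abitQ ∈ FP := andFn_mem_FP (notFn_mem_FP q0'_mem_FP) (comp_mem_FP xbitF_mem_FP xRec_mem_FP)
/-- `bbitQ ∈ FP`. [cite: AroraBarak2009, §1.3 (polynomial time is closed under composition and bounded loops)] -/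
theorem bbitQ_mem_FP : bbitQ ∈ FP := andFn_mem_FP q0'_mem_FP zbitF_mem_FP
/-- `abitQ` is one-bit. [cite: AroraBarak2009, §1.3 (polynomial time is closed under composition and bounded loops)] -/
theorem oneBit_abitQ : OneBit abitQ := oneBit_andFn (oneBit_notFn (oneBit_eqPairFn.comp _)) (oneBit_xbitF.comp _)
/-- `bbitQ` is one-bit. [cite: AroraBarak2009, §1.3 (polynomial time is closed under composition and bounded loops)] -/
theorem oneBit_bbitQ : OneBit bbitQ := oneBit_andFn (oneBit_eqPairFn.comp _) oneBit_zbitF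

section EntryValues

variable (x : List Bool) (t u : ℕ)

/-- `1ᵃ = ε ↔ a = 0`. [folklore] -/
private theorem decide_ones_eq_nil (a : ℕ) : decide (ones a = []) = decide (a = 0) := by
  cases a <;> simp [ones, List.replicate_succ]

/-- Value of `qρ'`. [folklore] -/
private theorem qρ'_rec : qρ' (CSSDistHard.rec x t u) =
    boolPair (ones (t / (nQ (mhat x) (nhat x) + mhat x))) (ones (t % (nQ (mhat x) (nhat x) + mhat x))) := by
  rw [qρ', Function.comp_apply, fanoutFn_apply, Function.comp_apply]
  simp only [CSSDistHard.rec, zX, zT, Function.comp_apply, fstF_boolPair, sndF_boolPair, mZx_apply, divModFn_boolPair]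

/-- Value of `q0'`. [folklore] -/
private theorem q0'_rec : q0' (CSSDistHard.rec x t u) = [decide (t / (nQ (mhat x) (nhat x) + mhat x) = 0)] := by
  rw [q0', Function.comp_apply, fanoutFn_apply, Function.comp_apply, qρ'_rec, fstF_boolPair, eqPairFn_boolPair,
    decide_ones_eq_nil]

/-- Value of `xRec`: the record of the shifted row index. [folklore] -/
private theorem xRec_rec : xRec (CSSDistHard.rec x t u) = CSSDistHard.rec x (t % (nQ (mhat x) (nhat x) + mhat x)) u := by
  rw [xRec, fanoutFn_apply, fanoutFn_apply, Function.comp_apply, qρ'_rec, sndF_boolPair]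
  simp only [CSSDistHard.rec, zX, Function.comp_apply, fstF_boolPair, sndF_boolPair]

/-- **Value of the X-part entry function.** [cite: KapshikarKundu2023, §2.2.1] -/
theorem abitQ_rec : abitQ (CSSDistHard.rec x t u) = [aEntry (Abits x) (ybits x) (mhat x) (nhat x) t u] := by
  have h : (xbitF ∘ xRec) (CSSDistHard.rec x t u) =
      [xEntry (Abits x) (ybits x) (mhat x) (t % (nQ (mhat x) (nhat x) + mhat x)) u] := by
    rw [Function.comp_apply, xRec_rec, xbitF_rec]
  rw [abitQ, andFn_apply (notFn_apply (q0'_rec x t u)) h, aEntry]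

/-- **Value of the Z-part entry function.** [cite: KapshikarKundu2023, §2.2.1] -/
theorem bbitQ_rec : bbitQ (CSSDistHard.rec x t u) = [bEntry (Abits x) (mhat x) (nhat x) t u] := by
  rw [bbitQ, andFn_apply (q0'_rec x t u) (zbitF_rec x t u), bEntry]

end EntryValues

/-! ### The machine: rows and the instance -/

/-- X-part of row `t` as a bit string. [cite: KapshikarKundu2023, §2.2.1] -/
def aRowBits (x : List Bool) (t : ℕ) : List Bool :=
  List.ofFn fun u : Fin (nQ (mhat x) (nhat x)) => aEntry (Abits x) (ybits x) (mhat x) (nhat x) t u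

/-- Z-part of row `t` as a bit string. [cite: KapshikarKundu2023, §2.2.1] -/
def bRowBits (x : List Bool) (t : ℕ) : List Bool :=
  List.ofFn fun u : Fin (nQ (mhat x) (nhat x)) => bEntry (Abits x) (mhat x) (nhat x) t u

/-- X-part of row `t`: fold of `abitQ` over `u < nQ` on `⟨x, 1ᵗ⟩`. [cite: AroraBarak2009, §1.3 (bounded loops)] -/
def aRowF : List Bool → List Bool := foldCat 1 P3 abitQ ∘ fanoutFn id (nQx ∘ fstF)
/-- Z-part of row `t`. [cite: AroraBarak2009, §1.3 (bounded loops)] -/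
def bRowF : List Bool → List Bool := foldCat 1 P3 bbitQ ∘ fanoutFn id (nQx ∘ fstF)
/-- The framed row `⟨⟨a, b⟩, ε⟩`. [cite: AroraBarak2009, §0.1] -/
def qFrameF : List Bool → List Bool := fanoutFn (fanoutFn aRowF bRowF) (fun _ => [])
/-- **The rows**: fold of the framed rows over `t < mZ + mX`. [cite: AroraBarak2009, §1.3 (bounded loops)] -/
def qRowsF : List Bool → List Bool := foldCat (6 * P3 + 6) (P3 + X + P3) qFrameF ∘ fanoutFn id rowsU
/-- The instance proper `⟨bin R, ⟨bin nQ, ⟨1^R, rows⟩⟩⟩`. [cite: KapshikarKundu2023, §2.2.1] -/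
def instQF : List Bool → List Bool :=
  fanoutFn (lenBinF ∘ rowsU) (fanoutFn (lenBinF ∘ nQx) (fanoutFn rowsU qRowsF))
/-- **The map on genuine arguments**: `⟨instance, bin (min(w,m)+1)⟩`. [cite: KapshikarKundu2023, §4 Theorem 2 (statement), §4.1] -/
def goodQF : List Bool → List Bool := fanoutFn instQF tauF

/-- `aRowF ∈ FP`. [cite: AroraBarak2009, §1.3 (polynomial time is closed under composition and bounded loops)] -/
theorem aRowF_mem_FP : aRowF ∈ FP :=
  comp_mem_FP (foldCat_mem_FP _ _ abitQ_mem_FP) (fanoutFn_mem_FP OracleCompose.id_mem_FP (comp_mem_FP nQx_mem_FP fstF_mem_FP))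
/-- `bRowF ∈ FP`. [cite: AroraBarak2009, §1.3 (polynomial time is closed under composition and bounded loops)] -/
theorem bRowF_mem_FP : bRowF ∈ FP :=
  comp_mem_FP (foldCat_mem_FP _ _ bbitQ_mem_FP) (fanoutFn_mem_FP OracleCompose.id_mem_FP (comp_mem_FP nQx_mem_FP fstF_mem_FP))
/-- `qRowsF ∈ FP`. [cite: AroraBarak2009, §1.3 (polynomial time is closed under composition and bounded loops)] -/
theorem qRowsF_mem_FP : qRowsF ∈ FP :=
  comp_mem_FP (foldCat_mem_FP _ _ (fanoutFn_mem_FP (fanoutFn_mem_FP aRowF_mem_FP bRowF_mem_FP) (const_mem_FP _)))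
    (fanoutFn_mem_FP OracleCompose.id_mem_FP rowsU_mem_FP)
/-- **`goodQF ∈ FP`.** [cite: AroraBarak2009, §1.3 (polynomial time is closed under composition and bounded loops)] -/
theorem goodQF_mem_FP : goodQF ∈ FP :=
  fanoutFn_mem_FP (fanoutFn_mem_FP (comp_mem_FP lenBinF_mem_FP rowsU_mem_FP)
    (fanoutFn_mem_FP (comp_mem_FP lenBinF_mem_FP nQx_mem_FP) (fanoutFn_mem_FP rowsU_mem_FP qRowsF_mem_FP))) tauF_mem_FP

section RowValues

variable (x : List Bool)

/-- Value of `P3` (re-proved; private upstream). [folklore] -/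
private theorem eval_P3 (L : ℕ) : P3.eval L = (L + 2) * (L + 2) * (L + 2) := by
  simp [P3, eval_mul, eval_add, eval_X]

/-- `nQ ≤ (L+2)³` for the clamped sizes (re-proved; private upstream). [folklore] -/
private theorem nQ_hat_le {L : ℕ} (hL : x.length ≤ L) : nQ (mhat x) (nhat x) ≤ (L + 2) * (L + 2) * (L + 2) := by
  have hm : mhat x ≤ x.length := Nat.min_le_right _ _
  have hn : nhat x ≤ x.length := Nat.min_le_right _ _
  unfold nQ
  exact Nat.mul_le_mul (Nat.mul_le_mul (by omega) (by omega)) (by omega)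

/-- `mX ≤ (L+2)³` (re-proved; private upstream). [folklore] -/
private theorem mX_hat_le {L : ℕ} (hL : x.length ≤ L) : nhat x * (mhat x + 1) ≤ (L + 2) * (L + 2) * (L + 2) := by
  have hm : mhat x ≤ x.length := Nat.min_le_right _ _
  have hn : nhat x ≤ x.length := Nat.min_le_right _ _
  exact (Nat.mul_le_mul (by omega : nhat x ≤ L + 2) (by omega : mhat x + 1 ≤ L + 2)).trans
    (Nat.le_mul_of_pos_right _ (by omega))

/-- **Value of `aRowF`.** [cite: KapshikarKundu2023, §2.2.1] -/
theorem aRowF_apply (t : ℕ) : aRowF (boolPair x (ones t)) = aRowBits x t := by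
  have hb : ∀ u, abitQ (boolPair (boolPair x (ones t)) (ones u)) = [aEntry (Abits x) (ybits x) (mhat x) (nhat x) t u] :=
    fun u => abitQ_rec x t u
  rw [aRowF, Function.comp_apply, fanoutFn_apply, Function.comp_apply, fstF_boolPair, nQx_apply, id,
    foldCat_apply (by rw [List.length_replicate, eval_P3, length_boolPair]; exact nQ_hat_le x (by omega))
      (fun u _ => by rw [eval_one, hb, List.length_singleton]), List.length_replicate]
  simp only [hb]
  exact ThreeDM.ccat_single_eq_ofFn _ _

/-- **Value of `bRowF`.** [cite: KapshikarKundu2023, §2.2.1] -/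
theorem bRowF_apply (t : ℕ) : bRowF (boolPair x (ones t)) = bRowBits x t := by
  have hb : ∀ u, bbitQ (boolPair (boolPair x (ones t)) (ones u)) = [bEntry (Abits x) (mhat x) (nhat x) t u] :=
    fun u => bbitQ_rec x t u
  rw [bRowF, Function.comp_apply, fanoutFn_apply, Function.comp_apply, fstF_boolPair, nQx_apply, id,
    foldCat_apply (by rw [List.length_replicate, eval_P3, length_boolPair]; exact nQ_hat_le x (by omega))
      (fun u _ => by rw [eval_one, hb, List.length_singleton]), List.length_replicate]
  simp only [hb]
  exact ThreeDM.ccat_single_eq_ofFn _ _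

/-- **Value of `qRowsF`**: the framed row codes `⟨⟨a_t, b_t⟩, ε⟩`. [cite: AroraBarak2009, §0.1] -/
theorem qRowsF_apply :
    qRowsF x = ccat (fun t => boolPair (boolPair (aRowBits x t) (bRowBits x t)) [])
      (nQ (mhat x) (nhat x) + mhat x + nhat x * (mhat x + 1)) := by
  have hm : mhat x ≤ x.length := Nat.min_le_right _ _
  rw [qRowsF, Function.comp_apply, fanoutFn_apply, rowsU_apply, id,
    foldCat_apply (by
        rw [List.length_replicate, eval_add, eval_add, eval_P3, eval_X]
        exact Nat.add_le_add (Nat.add_le_add (nQ_hat_le x le_rfl) hm) (mX_hat_le x le_rfl))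
      (fun t _ => by
        rw [qFrameF, fanoutFn_apply, fanoutFn_apply, aRowF_apply, bRowF_apply, length_boolPair, length_boolPair, aRowBits,
          bRowBits, List.length_ofFn, List.length_ofFn, List.length_nil, eval_add, eval_mul, eval_ofNat, eval_P3]
        have := nQ_hat_le x (le_refl x.length)
        omega), List.length_replicate]
  exact ccat_congr fun t _ => by rw [qFrameF, fanoutFn_apply, fanoutFn_apply, aRowF_apply, bRowF_apply]

end RowValues

/-! ### The code of the instance -/

/-- The framed body of a list code is the concatenation of one-item frames (re-proved; not in the cone). [folklore] -/
private theorem frames_ofFn_eq_ccat (c : ℕ → List Bool) (k : ℕ) :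
    frames (List.ofFn fun i : Fin k => c i) = ccat (fun i => boolPair (c i) []) k := by
  rw [frames_ofFn]
  exact ccat_congr fun i _ => by rw [boolPair_eq, List.append_nil]

/-- The code of a row of bits given by a Boolean table. [cite: AroraBarak2009, §0.1] -/
private theorem encode_boolRow {K : ℕ} (g : Fin K → Bool) :
    (encodingF2Vec K).encode (fun u => if g u then (1 : ZMod 2) else 0) = List.ofFn g := by
  show (List.ofFn fun u : Fin K => decide ((if g u then (1 : ZMod 2) else 0) = 1)) = _
  congr 1
  funext u
  cases g u <;> decide

/-- The code of the machine's stabilizer matrix. [cite: AroraBarak2009, §0.1] -/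
theorem encode_qRowsB (x : List Bool) :
    (encodingFinVec ((encodingF2Vec (nQ (mhat x) (nhat x))).pairBool (encodingF2Vec (nQ (mhat x) (nhat x))))
        (nQ (mhat x) (nhat x) + mhat x + nhat x * (mhat x + 1))).encode (qRowsB (Abits x) (ybits x) (mhat x) (nhat x)) =
      boolPair (ones (nQ (mhat x) (nhat x) + mhat x + nhat x * (mhat x + 1)))
        (ccat (fun t => boolPair (boolPair (aRowBits x t) (bRowBits x t)) [])
          (nQ (mhat x) (nhat x) + mhat x + nhat x * (mhat x + 1))) := by
  rw [finVec_encode_eq, boolPair_eq, OracleCompose.unaryEncodeNat_eq_replicate, ← frames_ofFn_eq_ccat]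
  congr 2
  refine List.ofFn_inj.2 (funext fun t => ?_)
  show boolPair ((encodingF2Vec _).encode _) ((encodingF2Vec _).encode _) = _
  rw [qRowsB, encode_boolRow, encode_boolRow, aRowBits, bRowBits]

/-- **The code of the string instance.** [cite: AroraBarak2009, §0.1] -/
theorem encode_strInstQ (x : List Bool) (m n : ℕ) :
    (encodingSympRows.pairBool encodingNatBool).encode (strInstQ x m n) =
      boolPair (boolPair (encodeNat (nQ m n + m + n * (m + 1))) (boolPair (encodeNat (nQ m n))
        ((encodingFinVec ((encodingF2Vec (nQ m n)).pairBool (encodingF2Vec (nQ m n))) (nQ m n + m + n * (m + 1))).encode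
          (qRowsB (Abits x) (ybits x) m n))))
        (encodeNat (min (CosetWeightsNP.wOf x) m + 1)) :=
  rfl

/-- **On any input `goodQF` outputs the code of the string instance with the clamped sizes.**
[cite: KapshikarKundu2023, §4 Theorem 2 (statement), §4.1] -/
theorem goodQF_apply (x : List Bool) :
    goodQF x = (encodingSympRows.pairBool encodingNatBool).encode (strInstQ x (mhat x) (nhat x)) := by
  rw [encode_strInstQ, encode_qRowsB, goodQF, fanoutFn_apply, instQF, fanoutFn_apply, fanoutFn_apply, fanoutFn_apply,
    Function.comp_apply, rowsU_apply, lenBinF_apply, List.length_replicate, Function.comp_apply, nQx_apply, lenBinF_apply,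
    List.length_replicate, qRowsF_apply, tauF_apply]

/-! ### The reduction -/

/-- **The reduction function** `COSETWEIGHTS → QMINDIST`. [cite: KapshikarKundu2023, §4 Theorem 2 (statement), §4.1] -/
def outQF : List Bool → List Bool :=
  iteFn CosetWeightsNP.T goodQF (fun _ => (encodingSympRows.pairBool encodingNatBool).encode badQ)

/-- **`outQF ∈ FP`.** [cite: AroraBarak2009, §1.3] -/
theorem outQF_mem_FP : outQF ∈ FP := iteFn_mem_FP CosetWeightsNP.T_mem_FP goodQF_mem_FP (const_mem_FP _)

/-- On a good shape the clamps are off (re-proved; private upstream). [folklore] -/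
private theorem clamps_of_goodShape {x : List Bool} (h : CosetWeightsNP.GoodShape x) :
    mhat x = CosetWeightsNP.mOf x ∧ nhat x = CosetWeightsNP.nOf x := by
  obtain ⟨hx, hy, -⟩ := h
  have hlen := congrArg List.length hx
  simp only [CosetWeightsNP.reb, length_boolPair, List.length_replicate] at hlen
  unfold CosetWeightsNP.mhat CosetWeightsNP.nhat at *
  omega

/-- **Under the guard, the input is a YES instance of COSET WEIGHTS iff the output is a YES instance
of QMD.** [cite: KapshikarKundu2023, §4 Theorem 2 (statement), §4.1] -/
theorem mem_iff_of_guard {x : List Bool} (h : CosetWeightsNP.T x = [true]) : x ∈ COSETWEIGHTS ↔ outQF x ∈ QMINDIST := by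
  have hG : CosetWeightsNP.GoodShape x := (CosetWeightsNP.T_eq_true_iff x).1 h
  obtain ⟨hm, hn⟩ := clamps_of_goodShape hG
  have h1 : x ∈ COSETWEIGHTS ↔ CosetWeightsNP.instOf x ∈ cosetWeightsSet := by
    conv_lhs => rw [← CosetWeightsNP.encode_instOf hG]
    exact Computability.Encoding.mem_toLanguage_iff _ _ _
  rw [h1, outQF, iteFn_apply_true h, goodQF_apply, hm, hn, QMINDIST, Computability.Encoding.mem_toLanguage_iff,
    strInstQ_mem_iff]

/-- Off the guard the output is the NO instance. [folklore] -/
private theorem outQF_of_not_guard {x : List Bool} (h : ¬ CosetWeightsNP.T x = [true]) :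
    outQF x = (encodingSympRows.pairBool encodingNatBool).encode badQ := by
  rw [outQF, iteFn_of_oneBit CosetWeightsNP.oneBit_T, if_neg h]

/-- **COSET WEIGHTS `≤ₚ` QMD (stabilizer-generator input)**: the polynomial-time map `outQF` sends the
code of `(A, y, w)` to the code of the stabilizer matrix of the `k = 1` CSS code of
`CSSDistanceHardness.lean` — a YES instance iff `(A, y, w)` is (`qInst_mem_iff`) — and every
other string to a NO instance. Not the printed reduction (see the module docstring).
[cite: KapshikarKundu2023, §4 Theorem 2 (statement), §4.1] -/
theorem COSETWEIGHTS_karpReducible_QMINDIST : COSETWEIGHTS ≤ₚ QMINDIST := by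
  refine ⟨outQF, outQF_mem_FP, fun x => ?_⟩
  show x ∈ COSETWEIGHTS ↔ outQF x ∈ QMINDIST
  by_cases hg : CosetWeightsNP.T x = [true]
  · exact mem_iff_of_guard hg
  · constructor
    · rintro ⟨I, -, rfl⟩
      exact absurd ((CosetWeightsNP.T_eq_true_iff _).2 (CosetWeightsNP.goodShape_encode I)) hg
    · intro hx
      rw [outQF_of_not_guard hg] at hx
      exact absurd ((Computability.Encoding.mem_toLanguage_iff _ _ _).1 hx) badQ_not_mem

end StabDistHard

/-- **Kapshikar–Kundu 2023, Theorem 2 (with §4.1): the minimum-distance problem for stabilizer codes,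
stabilizer-generator input, is NP-hard** — DISCHARGE of the named fact
`KapshikarKundu2023_quantumMinimumDistance_isNPHard`. Proof (this file and
`CSSDistanceHardness.lean`, not the printed route): the NP-hardness of COSET WEIGHTS
(`BerlekampMcElieceVanTilborg1978_cosetWeights_isNPHard`) transported along
`COSETWEIGHTS ≤ₚ QMINDIST` (`StabDistHard.COSETWEIGHTS_karpReducible_QMINDIST`) by
`IsHard.of_reducible_holds`. [cite: KapshikarKundu2023, §4 Theorem 2 and §4.1] -/
theorem KapshikarKundu2023_quantumMinimumDistance_isNPHard_holds :
    KapshikarKundu2023_quantumMinimumDistance_isNPHard :=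
  IsHard.of_reducible_holds BerlekampMcElieceVanTilborg1978_cosetWeights_isNPHard
    StabDistHard.COSETWEIGHTS_karpReducible_QMINDIST

end Literature.InformationTheory.QuantumCodes

end
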